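import Summits.QuantumFields.Balaban3D.Proofs.ChartFromBound25
import Summits.QuantumFields.Balaban3D.Proofs.Eq32FromInvariance

/-!
# Bałaban CMP 102 (1985) 255–275, d = 3 — prover seat p6 (lane `pub-balaban3d`): the expansion of the normalising
# term (61) «analogously to (60)» — the step leaf `Decomp35_61` of `B10SectAGathering.StepLeaves` from the LOCALIZED
# REPRESENTATION (63) of `log Z^{(k)}(B(Λ_{k+1}), ·)` taken AS CITED, with the small/large split of the localizations
# PROVED here (CARRIER-PARAMETRIC: any `T : B10.TowerRun`, any `P : StepPieces T k`, any cube carrier)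

Source: T. Bałaban, Commun. Math. Phys. **102** (1985) 255–275 [Balaban1985UV3] (= [B10]), p. 271 L20–36 and p. 272
L1–22 (renders `…/1985-cmp102-uv-stability-3d-p017-x2.png`, `…-p018-x2.png` read as images; journal page = PDF page
+ 254): «To complete the proof of the inductive assumption (41) we have to expand the term (61) analogously to (60). It
can be localized in a similar way, although a bit more complicated, as the perturbative expressions. We write it as the
logarithm of the Gaussian integral determined by the quadratic form ⟨A, Δ_kA⟩ and the δ-functions δ(QA)δ_{Ax}(A). We
eliminate the δ-functions … and we obtain the Gaussian integral determined by the positive quadratic form ⟨A, C*Δ_kCA⟩.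
The elimination yields also a sum of local terms … −log det S(V_k^{(k)}, b₀(c)). They are simple, local, gauge invariant
functions of V_k^{(k)} = Ū^k_{k+1}, and are analyzed in the same way as the perturbative expressions. We consider the
Gaussian integral now. Its logarithm is equal to a sum of an absolute constant, cancelled by the same constant from the
second term in (61), and the expression (63) … This gives an expansion for the sum above into gauge invariant, localized
expressions, with proper exponential decay properties. These are analyzed further in the same way as the perturbative
terms. … By the above formula this gives an expansion of the last integral in (63) into a sum of gauge invariant,
localized terms. They are again analyzed in the way described before. Now let us notice that gathering together the
first terms in the expansions (30) we obtain the expansion of (63) for the external field U_{k+1} = 1. This is cancelled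
by the second term in (61), and we obtain the desired expansion.»; k = 0: p. 265 L14–16 «The term log Z^{(0)}(Ω₁, U₁) −
log Z^{(0)}(Ω₁, 1) can be decomposed in a similar way as the integral in (24), and we get an expression Σ_Y 𝒫₁(Y, U₁)
which is identical to the expression on the right-hand side of (33), only the coefficients do not depend on g₀.»

HONEST FRAMING (lane PLAN.md §0).  [B10] proves UV stability of the d = 3 lattice gauge theory on a finite torus — NOT
a continuum limit, NOT infinite volume, NOT a mass gap, NOT d = 4, NOT Clay.  Nothing of the paper is asserted here.
WHAT THE LANE DEFINES (seat p1, `Carriers.StepSeries`, ruling R-FL): `logZU h U := J_U + log ∫ e^{−½⟨v, Q_U v⟩}`,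
`logZ1 h := J_1 + log ∫ e^{−½⟨v, Q_1 v⟩}` — the Gaussian form of the first two printed sentences.  WHAT THIS FILE TAKES
AS AN INPUT, typed as the hypothesis structure `LogZLocalization` («(63) AS CITED»; NOT IN PRINT quantitatively — the
print cites [5] (3.156), (3.183), (3.185) and [4] (124) for it; it is the lane's GAP binder G3D-07
`Balaban1985CMP102.Binders.LogZLocalizedAsCited` BY NAME, fed in through `LogZLocalization.ofCited` below):
the DIFFERENCE of the two logarithms IS a sum, over the localization domains inside `B(Λ_{k+1}(h))`, of «gauge invariant,
localized» chart-analytic functions `Ψ_X` of the SAME chart configuration `B` of (27) (p. 271 L1–3) at `B(h, U)` minus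
the same at `B = 0` (the absolute constant and «the expansion of (63) for the external field U_{k+1} = 1» cancel), with the complex
half-ball bound `C63·e^{−κ𝓛(X)}` WITHOUT a factor g_k («only the coefficients do not depend on g₀», p. 265 L16) — the
lane's GAP binder G3D-01 `Binders.ChartAnalyticityAsCited` BY NAME —, the vanishing first derivative (32) («analyzed in
the same way as the perturbative expressions»; discharged at `run3` from gauge invariance by
`…Balaban3D.Eq32FromInvariance`), and the far monomials under G3D-06 `Binders.FarTermsDecayAsCited` BY NAME.
WHAT IS KERNEL-CHECKED: the passage from that input to the leaf `Decomp35_61 P C₄` — the retained («contained in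
cubes of the size R(g_k)M₁») domains are expanded to sixth order by the sibling `Representation33.ChartExpansion`
(seventh-order Cauchy remainder, `rawConst7`), the LARGE domains inside `B(Λ_{k+1})` (which the Gaussian logarithm
contains but Σ_Y 𝒫(Y, U) does not, «in a similar way as the integral in (24)») are moved to the remainder by (25)-type
decay at threshold `R₁r(g_k)` (LQB `B10Eq59Localization.sum_abs_act_large_le_of_bound25`, `B10Assembly.rawR_le`:
`rawConstR`, located side conditions `r₀ ≥ 1`, `R₁ ≥ 6 + 2κ₀`, `κ ≥ κ₀(c₀, Δ) + 1` of the 4D cell), giving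
`C₄ := rawConst7 Craw b₀ r₀ p₀ g κ₀ + rawConstR (2·C63·K₀(c₀, Δ)) R₁ g κ₀`, k- and ε-free (lane R-CONST).
PLACEMENT: lane cell topic `Summits/QuantumFields/Balaban3D/Proofs/`.  Record: HOME `run/shared/lean/pub/pub-balaban3d/`.
-/

noncomputable section

open scoped Topology
open Metric Set Finset
open Literature.MathematicalPhysics.QuantumFieldTheory.Balaban1983to89
open Literature.MathematicalPhysics.QuantumFieldTheory.Balaban1983to89.B10
open Literature.MathematicalPhysics.QuantumFieldTheory.Balaban1983to89.B10SectAGathering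
open Literature.MathematicalPhysics.QuantumFieldTheory.Balaban1983to89.B10Assembly
open Literature.MathematicalPhysics.QuantumFieldTheory.Balaban1983to89.B12TreeDecay (CubeSystem kappa₀ K₀ K₀_pos)
open Literature.MathematicalPhysics.QuantumFieldTheory.Balaban1985CMP102.Binders
  (ChartAnalyticityAsCited FarTermsDecayAsCited LogZLocalizedAsCited)
open Summit.QuantumFields.Balaban3D.Proofs.Representation33
open Summit.QuantumFields.Balaban3D.Proofs.VacuumAndBooking
open Summit.QuantumFields.Balaban3D.Proofs.ChartFromBound25

namespace Summit.QuantumFields.Balaban3D.Proofs.LogZLocalized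

variable {T : TowerRun} {k : ℕ}

/-- HYPOTHESIS STRUCTURE «(63) AS CITED» — the localized representation of the two normalising logarithms of (61) at
step k (p. 271 L22–36, p. 272 L1–20; k = 0: p. 265 L14–16), over a system `S` of localization domains, the chart
space `E` and chart configurations `Bcfg` of (27) (p. 271 L1–3: «The configuration B restricted to □₁^{(k+1)} = □₁ ∩
T^{(k+1)} is given by the formula (27)»), the finite set `dom h` of the localization domains INSIDE `B(Λ_{k+1}(h))` (all
sizes), a constant profile `κc` and a decay `(κ, C63)`.  Fields: `Ψ X` = the localized, gauge invariant piece of «the expression (63)» + «the sum of terms −log det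
S(V_k^{(k)}, b₀(c))» with localization `X`, as an analytic function of `B`; `expandDiff` = the DIFFERENCE (61) of the two
logarithms IS the sum over the domains inside `B(Λ_{k+1}(h))` of the pieces at `B(h, U)` minus the pieces at `B = 0`
(the absolute constant «cancelled by the same constant from the second term in (61)», «the expansion of (63) for the
external field U_{k+1} = 1 … is cancelled by the second term in (61)» — only the difference is asserted, as printed); `chart` = «localized expressions, with proper exponential decay properties» made
quantitative: the lane's GAP binder G3D-01 `ChartAnalyticityAsCited (Ψ X) ρ (C63·e^{−κ𝓛(X)})` (NO factor g_k: p. 265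
L16 «only the coefficients do not depend on g₀»); `eq32` = (32) for these pieces («analyzed in the same way as the
perturbative expressions»; p. 271 L6–8); `far`/`far_le` = the dropped far monomials under G3D-06
`FarTermsDecayAsCited`.  NOT IN PRINT as a quantitative statement (the print cites [5] (3.156), (3.183), (3.185), Thm
3.15 and [4] (124)); nothing is constructed here. [cite: Balaban1985UV3, (61)–(63) pp.271–272 + (35) p.265] -/
structure LogZLocalization (T : TowerRun) (k : ℕ) {S : LocDomainSys} (E : Type)
    [NormedAddCommGroup E] [NormedSpace ℂ E] (κc : ChartConsts) (κ C63 : ℝ)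
    (logZU : T.Hist (k + 1) → T.Cfg (k + 1) → ℝ) (logZ1 : T.Hist (k + 1) → ℝ)
    (Bcfg : S.Dom → T.Hist (k + 1) → T.Cfg (k + 1) → E) (dom : T.Hist (k + 1) → Finset S.Dom) where
  /-- the localized pieces of (63) (and of the elimination terms), through the chart of (27) -/
  Ψ : S.Dom → E → ℂ
  /-- (61) localized: `log Z^{(k)}(B(Λ_{k+1}), U_{k+1}) − log Z^{(k)}(B(Λ_{k+1}), 1) = Σ_{X ⊂ B(Λ_{k+1})} (Re Ψ_X(B(h,U))
  − Re Ψ_X(0))` — the expansions of the two logarithms AGREE in their absolute constant («cancelled by the same constant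
  from the second term in (61)») and in nothing else but the pieces at `B(h, U)` resp. at `B = 0` («the expansion of
  (63) for the external field U_{k+1} = 1 … is cancelled by the second term in (61)»); only the DIFFERENCE is asserted,
  exactly as printed -/
  expandDiff : ∀ h U, logZU h U - logZ1 h = ∑ X ∈ dom h, ((Ψ X (Bcfg X h U)).re - (Ψ X 0).re)
  /-- G3D-01 for the pieces, at the g-free rate `C63·e^{−κ𝓛(X)}` -/
  chart : ∀ X, ChartAnalyticityAsCited (Ψ X) κc.ρ (C63 * Real.exp (-(κ * S.dj X)))
  /-- (32) for the pieces -/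
  eq32 : ∀ X, fderiv ℂ (Ψ X) 0 = 0
  /-- the far monomials of the pieces -/
  far : S.Dom → T.Hist (k + 1) → T.Cfg (k + 1) → ℝ
  /-- … under G3D-06 -/
  far_le : FarTermsDecayAsCited far (fun X => C63 * Real.exp (-(κ * S.dj X))) κc.Cfar
    (T.g k ^ 7 * (rFun κc.r₀ (T.g k) * pFun T.b₀ T.p₀ (T.g k)) ^ 7)

namespace LogZLocalization

variable {S : LocDomainSys} {E : Type} [NormedAddCommGroup E] [NormedSpace ℂ E]
  {κc : ChartConsts} {κ C63 : ℝ} {logZU : T.Hist (k + 1) → T.Cfg (k + 1) → ℝ} {logZ1 : T.Hist (k + 1) → ℝ}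
  {Bcfg : S.Dom → T.Hist (k + 1) → T.Cfg (k + 1) → E} {dom : T.Hist (k + 1) → Finset S.Dom}
  (Λ : LogZLocalization T k E κc κ C63 logZU logZ1 Bcfg dom)

/-- The difference of one piece at the chart configuration and at `0` is bounded by twice the half-ball bound whenever
the configuration obeys (28) with `s ≤ ρ/4`: `|Re Ψ_X(B) − Re Ψ_X(0)| ≤ 2·C63·e^{−κ𝓛(X)}` — in LQB's typing, the pair
difference satisfies `Bound25Printed` at «coupling» 1 with constant `2·C63`. [cite: Balaban1985UV3, (25) p.262 + (63) p.272] -/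
theorem bound25_diff
    (bound28 : ∀ X h U, ‖Bcfg X h U‖ ≤ κc.cB * (rFun κc.r₀ (T.g k) * T.g k * pFun T.b₀ T.p₀ (T.g k)))
    (small28 : κc.cB * (rFun κc.r₀ (T.g k) * T.g k * pFun T.b₀ T.p₀ (T.g k)) ≤ κc.ρ / 4) (h : T.Hist (k + 1)) :
    Bound25Printed ⟨S.Dom, T.Cfg (k + 1), S.dj, fun X U => (Λ.Ψ X (Bcfg X h U)).re - (Λ.Ψ X 0).re⟩ 1 κ (2 * C63) := by
  intro X U
  have hρ : 0 < κc.ρ := (Λ.chart X).1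
  have hB : Bcfg X h U ∈ closedBall (0 : E) (κc.ρ / 2) := by
    rw [mem_closedBall, dist_zero_right]; linarith [bound28 X h U]
  have h0 : (0 : E) ∈ closedBall (0 : E) (κc.ρ / 2) := mem_closedBall_self (by positivity)
  have h1 := (Λ.chart X).2.2 _ hB
  have h2 := (Λ.chart X).2.2 _ h0
  show |(Λ.Ψ X (Bcfg X h U)).re - (Λ.Ψ X 0).re| ≤ 2 * C63 * 1 * Real.exp (-(κ * S.dj X))
  calc |(Λ.Ψ X (Bcfg X h U)).re - (Λ.Ψ X 0).re|
      ≤ |(Λ.Ψ X (Bcfg X h U)).re| + |(Λ.Ψ X 0).re| := abs_sub _ _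
    _ ≤ ‖Λ.Ψ X (Bcfg X h U)‖ + ‖Λ.Ψ X 0‖ := add_le_add (Complex.abs_re_le_norm _) (Complex.abs_re_le_norm _)
    _ ≤ 2 * C63 * 1 * Real.exp (-(κ * S.dj X)) := by linarith

/-- **Smart constructor — «(63) as cited» with the invariance AS PRINTED** (lane rulings R-G7 / R-32 / R-32′): the same
data with, in place of the field `eq32`, the invariance of the pieces under an action `π` of «the global transformations
R(U), U ∈ G» (p. 264 L2–3) on the chart ball («gauge invariant, localized expressions», p. 272 L10–11) and the DETECTING
property of `π` («the only element invariant is 0», p. 264 L7; the lane theorem `Eq32FromInvariance.detecting_pi` ∘ seat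
p4's `hdet_lieC` for the diagonal adjoint action on 𝔤ᶜ-valued bond functions); (32) for the pieces is then DERIVED by
`Eq32FromInvariance.fderiv_eq_zero_of_invariant`.  This is the shape of the lane's GAP binder G3D-07
`Binders.LogZLocalizedAsCited` (explicit scalars ρ = κc.ρ, r₀ = κc.r₀, Cfar = κc.Cfar). [cite: Balaban1985UV3, (61)–(63) pp.271–272 + (26)/(32) pp.263–264] -/
def ofInvariant {Γ : Type*} (π : Γ → E →L[ℂ] E) (Ψ : S.Dom → E → ℂ)
    (expandDiff : ∀ h U, logZU h U - logZ1 h = ∑ X ∈ dom h, ((Ψ X (Bcfg X h U)).re - (Ψ X 0).re))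
    (chart : ∀ X, ChartAnalyticityAsCited (Ψ X) κc.ρ (C63 * Real.exp (-(κ * S.dj X))))
    (inv26 : ∀ X (u : Γ), ∀ b ∈ ball (0 : E) κc.ρ, π u b ∈ ball (0 : E) κc.ρ → Ψ X (π u b) = Ψ X b)
    (hdet : ∀ φ : E →L[ℂ] ℂ, (∀ u, φ.comp (π u) = φ) → φ = 0)
    (far : S.Dom → T.Hist (k + 1) → T.Cfg (k + 1) → ℝ)
    (far_le : FarTermsDecayAsCited far (fun X => C63 * Real.exp (-(κ * S.dj X))) κc.Cfar
      (T.g k ^ 7 * (rFun κc.r₀ (T.g k) * pFun T.b₀ T.p₀ (T.g k)) ^ 7)) :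
    LogZLocalization T k E κc κ C63 logZU logZ1 Bcfg dom where
  Ψ := Ψ
  expandDiff := expandDiff
  chart := chart
  eq32 := fun X => Eq32FromInvariance.fderiv_eq_zero_of_invariant (Ψ X) π (chart X).1
    ((chart X).2.1.differentiableAt (isOpen_ball.mem_nhds (mem_ball_self (chart X).1))) (inv26 X) hdet
  far := far
  far_le := far_le

/-- **G3D-07 BY NAME ⇒ the C7 hypothesis structure**: the lane's GAP binder `Binders.LogZLocalizedAsCited T k E π κc.ρ
κc.r₀ κc.Cfar C63 κ logZU logZ1 Bcfg dom` (the localized expansion of the difference (61) AS CITED — pieces `Ψ`, far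
monomials `far`, `expandDiff`, G3D-01 `chart` at the g-free rate, the invariance `inv26` typed as printed, G3D-06
`far_le`; tree `Balaban1985CMP102.Binders` §3) together with the DETECTING property of the action `π` («the only
element invariant is 0», p. 264 L7; the lane theorem `Eq32FromInvariance.detecting_pi` ∘ seat p4's `hdet_lieC` at the
pinned chart space of ruling R-32′) gives `LogZLocalization T k E κc κ C63 logZU logZ1 Bcfg dom` — (32) for the pieces
DERIVED (`ofInvariant`). [cite: Balaban1985UV3, (61)–(63) pp.271–272 + (26)/(32) pp.263–264] -/
def ofCited {Γ : Type} {π : Γ → E →L[ℂ] E}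
    (Λc : LogZLocalizedAsCited T k E π κc.ρ κc.r₀ κc.Cfar C63 κ logZU logZ1 Bcfg dom)
    (hdet : ∀ φ : E →L[ℂ] ℂ, (∀ u, φ.comp (π u) = φ) → φ = 0) :
    LogZLocalization T k E κc κ C63 logZU logZ1 Bcfg dom :=
  ofInvariant π Λc.Ψ Λc.expandDiff Λc.chart Λc.inv26 hdet Λc.far Λc.far_le

/-- `ofCited` keeps the binder's pieces and far monomials (definitional; so that the identification `hPYZ` of the C7
leaf is stated on the binder's `Ψ`, `far`). [folklore] -/
theorem ofCited_Ψ {Γ : Type} {π : Γ → E →L[ℂ] E}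
    (Λc : LogZLocalizedAsCited T k E π κc.ρ κc.r₀ κc.Cfar C63 κ logZU logZ1 Bcfg dom)
    (hdet : ∀ φ : E →L[ℂ] ℂ, (∀ u, φ.comp (π u) = φ) → φ = 0) :
    (ofCited Λc hdet).Ψ = Λc.Ψ ∧ (ofCited Λc hdet).far = Λc.far := ⟨rfl, rfl⟩

omit [NormedSpace ℂ E] in
/-- From the TWO expansions with a common absolute constant (`log Z(·,U) = Jabs + Σ Re Ψ_X(B)`, `log Z(·,1) = Jabs +
Σ Re Ψ_X(0)`) to the localized difference `expandDiff` — the printed cancellation, as bookkeeping. [cite: Balaban1985UV3, (61) p.271 + p.272 L19–22] -/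
theorem expandDiff_of_expansions (Ψ : S.Dom → E → ℂ) (Jabs : T.Hist (k + 1) → ℝ)
    (expandU : ∀ h U, logZU h U = Jabs h + ∑ X ∈ dom h, (Ψ X (Bcfg X h U)).re)
    (expand1 : ∀ h, logZ1 h = Jabs h + ∑ X ∈ dom h, (Ψ X 0).re) (h : T.Hist (k + 1)) (U : T.Cfg (k + 1)) :
    logZU h U - logZ1 h = ∑ X ∈ dom h, ((Ψ X (Bcfg X h U)).re - (Ψ X 0).re) := by
  rw [expandU h U, expand1 h, Finset.sum_sub_distrib]; ring

end LogZLocalization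

/-- **(61) expanded «analogously to (60)», RAW FORM** (p. 271 L20–21, p. 272 L18–20; k = 0: p. 265 L14–16 «in a
similar way as the integral in (24)»): IF the step pieces `logZU`, `logZ1` admit the localized representation
`LogZLocalization` («(63) as cited») on a cube carrier with κ ≥ κ₀(c₀, Δ) + 1 («κ can be arbitrarily large if M₁ is
sufficiently large», p. 262), the chart configurations obey (28) with `s ≤ ρ/4`, and `PYZ h U` IS the retained
order-2…6 jet of the pieces over the domains «contained in cubes of the size R(g_k)M₁» inside `B(Λ_{k+1}(h))`
(`(dom h).filter (𝓛 < R₁r(g_k))`), THEN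
`|logZU − logZ1 − PYZ| ≤ Craw·g_k⁷(r(g_k)p(g_k))⁷·#blocks + (2·C63·K₀(c₀,Δ))·e^{−R₁r(g_k)}·#blocks`:
the retained domains by `Representation33.ChartExpansion.abs_total_sub_le` (orders 0 cancel, order 1 vanishes by
(32), orders 2–6 = `PYZ` + far, seventh-order Cauchy remainder), the large domains by (25)-type decay at threshold
`R₁r(g_k)` (LQB `B10Eq59Localization.sum_abs_act_large_le_of_bound25`). [cite: Balaban1985UV3, (61)–(63) pp.271–272 + (35) p.265] -/
theorem abs_decomp61_le (P : StepPieces T k) {S : LocDomainSys} (G : CubeSystem S) {Δ : ℕ} {c₀ κ C63 : ℝ}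
    (hΔ : G.DegreeLE Δ) (hV : G.VolumeLeaf c₀) (hκ : kappa₀ c₀ Δ + 1 ≤ κ)
    {E : Type} [NormedAddCommGroup E] [NormedSpace ℂ E] [FiniteDimensional ℂ E] (κc : ChartConsts)
    (hCM : C63 * K₀ c₀ Δ ≤ κc.CM) (Bcfg : S.Dom → T.Hist (k + 1) → T.Cfg (k + 1) → E)
    (bound28 : ∀ X h U, ‖Bcfg X h U‖ ≤ κc.cB * (rFun κc.r₀ (T.g k) * T.g k * pFun T.b₀ T.p₀ (T.g k)))
    (small28 : κc.cB * (rFun κc.r₀ (T.g k) * T.g k * pFun T.b₀ T.p₀ (T.g k)) ≤ κc.ρ / 4)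
    (dom : T.Hist (k + 1) → Finset S.Dom) (hcard : (Fintype.card G.Cube : ℝ) ≤ T.sites k)
    (Λ : LogZLocalization T k E κc κ C63 P.logZU P.logZ1 Bcfg dom) (hC63 : 0 ≤ C63) (R₁ : ℝ)
    (hR : 0 ≤ R₁ * rFun κc.r₀ (T.g k)) (hg : 0 < T.g k) (hg1 : T.g k ≤ 1) (hb₀ : 0 ≤ T.b₀)
    (hPYZ : ∀ h U, P.PYZ h U = ∑ X ∈ (dom h).filter (fun X => S.dj X < R₁ * rFun κc.r₀ (T.g k)),
      ((jet26 (Λ.Ψ X) (Bcfg X h U)).re - Λ.far X h U))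
    (h : T.Hist (k + 1)) (U : T.Cfg (k + 1)) :
    |P.logZU h U - P.logZ1 h - P.PYZ h U|
      ≤ κc.Craw * (T.g k ^ 7 * (rFun κc.r₀ (T.g k) * pFun T.b₀ T.p₀ (T.g k)) ^ 7) * Fintype.card G.Cube
        + (2 * C63 * K₀ c₀ Δ) * Real.exp (-(R₁ * rFun κc.r₀ (T.g k))) * Fintype.card G.Cube := by
  classical
  have hκ' : kappa₀ c₀ Δ ≤ κ := by linarith
  -- the chart expansion of the RETAINED domains
  set R : ℝ := R₁ * rFun κc.r₀ (T.g k) with hRdef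
  let D : ChartExpansion T k S.Dom E κc :=
    ofDecay G hΔ hV hκ' hC63 κc hCM (fun h => (dom h).filter (fun X => S.dj X < R)) Λ.Ψ
      (fun X => C63 * Real.exp (-(κ * S.dj X))) Λ.chart (fun X => le_rfl) Bcfg bound28 small28 Λ.eq32 hcard
      Λ.far Λ.far_le
  have hsmall := D.abs_total_sub_le hg hg1 hb₀ h U
  -- the LARGE domains inside B(Λ_{k+1}(h)): (25)-type decay at threshold R₁ r(g_k)
  let act : S.Dom → T.Cfg (k + 1) → ℝ := fun X U => (Λ.Ψ X (Bcfg X h U)).re - (Λ.Ψ X 0).re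
  have h25 := Λ.bound25_diff bound28 small28 h
  have hCg : 0 ≤ 2 * C63 * (1 : ℝ) := by positivity
  have hlarge₁ : ∑ X ∈ (dom h).filter (fun X => ¬ S.dj X < R), |act X U|
      ≤ ∑ X ∈ Finset.univ.filter (fun X : S.Dom => R ≤ S.dj X), |act X U| := by
    refine Finset.sum_le_sum_of_subset_of_nonneg (fun X hX => ?_) fun X _ _ => abs_nonneg _
    simp only [Finset.mem_filter, Finset.mem_univ, true_and, not_lt] at hX ⊢
    exact hX.2
  have hlarge₂ := B10Eq59Localization.sum_abs_act_large_le_of_bound25 G hΔ hV hκ' act hCg h25 U R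
  have hexp : Real.exp (-(κ - kappa₀ c₀ Δ) * R) ≤ Real.exp (-R) := Real.exp_le_exp.mpr (by nlinarith)
  have hcoef : 0 ≤ 2 * C63 * 1 * K₀ c₀ Δ * (Fintype.card G.Cube : ℝ) :=
    mul_nonneg (mul_nonneg hCg (K₀_pos c₀ Δ).le) (Nat.cast_nonneg _)
  have hlarge : |∑ X ∈ (dom h).filter (fun X => ¬ S.dj X < R), act X U|
      ≤ (2 * C63 * K₀ c₀ Δ) * Real.exp (-R) * Fintype.card G.Cube := by
    refine (Finset.abs_sum_le_sum_abs _ _).trans (hlarge₁.trans (hlarge₂.trans ?_))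
    calc 2 * C63 * 1 * K₀ c₀ Δ * Real.exp (-(κ - kappa₀ c₀ Δ) * R) * Fintype.card G.Cube
        = (2 * C63 * 1 * K₀ c₀ Δ * Fintype.card G.Cube) * Real.exp (-(κ - kappa₀ c₀ Δ) * R) := by ring
      _ ≤ (2 * C63 * 1 * K₀ c₀ Δ * Fintype.card G.Cube) * Real.exp (-R) :=
          mul_le_mul_of_nonneg_left hexp hcoef
      _ = (2 * C63 * K₀ c₀ Δ) * Real.exp (-R) * Fintype.card G.Cube := by ring
  -- the algebra: (61) − PYZ = (retained: total − total0 − poly) + (large: Σ act)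
  have hsplit := Finset.sum_filter_add_sum_filter_not (dom h) (fun X => S.dj X < R) (fun X => act X U)
  have hdecomp : P.logZU h U - P.logZ1 h - P.PYZ h U
      = (D.total h U - D.total0 h - D.poly h U) + ∑ X ∈ (dom h).filter (fun X => ¬ S.dj X < R), act X U := by
    have hins : P.logZU h U - P.logZ1 h = ∑ X ∈ dom h, act X U := Λ.expandDiff h U
    have hret : D.total h U - D.total0 h = ∑ X ∈ (dom h).filter (fun X => S.dj X < R), act X U := by
      show ∑ X ∈ (dom h).filter (fun X => S.dj X < R), (Λ.Ψ X (Bcfg X h U)).re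
          - ∑ X ∈ (dom h).filter (fun X => S.dj X < R), (Λ.Ψ X 0).re = _
      rw [← Finset.sum_sub_distrib]
    have hpoly : D.poly h U = P.PYZ h U := (hPYZ h U).symm
    rw [hins, ← hsplit, hpoly]
    linarith [hret]
  rw [hdecomp]
  exact (abs_add_le _ _).trans (add_le_add hsmall hlarge)

/-- **Leaf `Decomp35_61` of `B10SectAGathering.StepLeaves` from «(63) as cited»** — the TYPE is literally the leaf:
`abs_decomp61_le` with the two raw remainders converted along the run `g_k = g(L^kε)^{1/2} ≤ 1`, `rem = (L^kε)^{3+κ₀}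
|T₁^{(k)}|` by LQB `B10Assembly.raw7_le` (0 < κ₀ < ½) and `B10Assembly.rawR_le` (the located side conditions `r₀ ≥ 1`,
`R₁ ≥ 6 + 2κ₀` of «exp(−R), which is smaller than arbitrary power of ε», p. 262): the k-, ε-free constant
`C₄ := rawConst7 Craw b₀ r₀ p₀ g κ₀ + rawConstR (2·C63·K₀(c₀,Δ)) R₁ g κ₀`. [cite: Balaban1985UV3, (61) p.271 + (35) p.265 + p.262] -/
theorem decomp35_61_of_localization (P : StepPieces T k) {S : LocDomainSys} (G : CubeSystem S) {Δ : ℕ}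
    {c₀ κ C63 : ℝ} (hΔ : G.DegreeLE Δ) (hV : G.VolumeLeaf c₀) (hκ : kappa₀ c₀ Δ + 1 ≤ κ)
    {E : Type} [NormedAddCommGroup E] [NormedSpace ℂ E] [FiniteDimensional ℂ E] (κc : ChartConsts)
    (hCM : C63 * K₀ c₀ Δ ≤ κc.CM) (hr₀ : 1 ≤ κc.r₀) (Bcfg : S.Dom → T.Hist (k + 1) → T.Cfg (k + 1) → E)
    (bound28 : ∀ X h U, ‖Bcfg X h U‖ ≤ κc.cB * (rFun κc.r₀ (T.g k) * T.g k * pFun T.b₀ T.p₀ (T.g k)))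
    (small28 : κc.cB * (rFun κc.r₀ (T.g k) * T.g k * pFun T.b₀ T.p₀ (T.g k)) ≤ κc.ρ / 4)
    (dom : T.Hist (k + 1) → Finset S.Dom) (hcard : (Fintype.card G.Cube : ℝ) ≤ T.sites k)
    (Λ : LogZLocalization T k E κc κ C63 P.logZU P.logZ1 Bcfg dom) (hC63 : 0 ≤ C63)
    (g L ε κ₀ R₁ : ℝ) (hg : 0 < g) (hL : 0 < L) (hε : 0 < ε) (hκ₀ : 0 < κ₀) (hκ₀' : κ₀ < 1 / 2)
    (hR₁ : 6 + 2 * κ₀ ≤ R₁) (hp₀ : 0 < T.p₀) (hb₀ : 0 ≤ T.b₀)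
    (hgk : T.g k = gRun g L ε k) (hgk1 : T.g k ≤ 1)
    (hrem : P.rem = (L ^ k * ε) ^ (3 + κ₀) * T.sites k)
    (hPYZ : ∀ h U, P.PYZ h U = ∑ X ∈ (dom h).filter (fun X => S.dj X < R₁ * rFun κc.r₀ (T.g k)),
      ((jet26 (Λ.Ψ X) (Bcfg X h U)).re - Λ.far X h U)) :
    Decomp35_61 P (rawConst7 κc.Craw T.b₀ κc.r₀ T.p₀ g κ₀ + rawConstR (2 * C63 * K₀ c₀ Δ) R₁ g κ₀) := by
  intro h U
  have hgpos : 0 < T.g k := by rw [hgk]; exact gRun_pos g L ε hg hL hε k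
  have hR : 0 ≤ R₁ * rFun κc.r₀ (T.g k) := mul_nonneg (by linarith) (rFun_nonneg κc.r₀ (T.g k) hgpos hgk1)
  have hcard0 : (0 : ℝ) ≤ Fintype.card G.Cube := Nat.cast_nonneg _
  have h1 := abs_decomp61_le P G hΔ hV hκ κc hCM Bcfg bound28 small28 dom hcard Λ hC63 R₁ hR hgpos hgk1 hb₀ hPYZ h U
  have hC63K : 0 ≤ 2 * C63 * K₀ c₀ Δ := by have := K₀_pos c₀ Δ; positivity
  have h7 := raw7_le (T := T) (k := k) κc.Craw κc.r₀ (Fintype.card G.Cube : ℝ) g L ε κ₀ hg hL hε hκ₀' κc.r₀_nonneg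
    hp₀ hb₀ κc.Craw_nonneg hgk hgk1 hcard0 hcard
  have hRw := rawR_le (T := T) (k := k) (2 * C63 * K₀ c₀ Δ) κc.r₀ R₁ (Fintype.card G.Cube : ℝ) g L ε κ₀ hg hL hε hκ₀
    hr₀ hR₁ hC63K hgk hgk1 hcard0 hcard
  rw [hrem, add_mul]
  exact h1.trans (add_le_add h7 hRw)

end Summit.QuantumFields.Balaban3D.Proofs.LogZLocalized

end
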